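/-
Origin: expansion seat `planner-pub-hodgecm-pv02-g7-0`, handover TWO: `import Pv02g7.WeilThetaModelDeriv` -> `import HodgeCM.Automorphic.WeilThetaModelDeriv`; `import Pv02g7.WeilThetaModelHeisenbergLinear` -> `import HodgeCM.Automorphic.WeilThetaModelHeisenbergLinear`; other imports Mathlib.Analysis.SpecialFunctions.ExpDeriv, Mathlib.Analysis.Complex.RealDeriv unchanged ; after pv02-g7 #3 WeilThetaModelHeisenbergLinear (row 1) AND #4 WeilThetaModelDeriv (row 2) (`HOME/pub-hodgecm-pv02-g7/lean/Pv02g7/WeilThetaModelDerivCentral.lean`, md5 54a49e44, 285 lines);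
landed by the gen-8 packager in gate run 30 as `HodgeCM/Automorphic/WeilThetaModelDerivCentral.lean` (import ^import Pv02g7\.WeilThetaModelHeisenbergLinear[ \t]*$→import HodgeCM.Automorphic.WeilThetaModelHeisenbergLinear ×1; import ^import Pv02g7\.WeilThetaModelDeriv[ \t]*$→import HodgeCM.Automorphic.WeilThetaModelDeriv ×1).
-/
/-
Copyright (c) 2026. All rights reserved.
Released under Apache 2.0 license as described in the file LICENSE.
Origin: pub-hodgecm-pv02-g7 (DAG-node prover #02, gen 7), file #5; target
`HodgeCM/Automorphic/WeilThetaModelDerivCentral.lean`.  NEW ADDITIVE LEAF; imports this seat's #3 and #4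
under their WIP names (`Pv02g7.…` ↦ `HodgeCM.Automorphic.…` at landing) and Mathlib only.
-/
import Summits.HodgeConjecture.HodgeCM.Automorphic.WeilThetaModelDeriv
import Summits.HodgeConjecture.HodgeCM.Automorphic.WeilThetaModelHeisenbergLinear
import Mathlib.Analysis.SpecialFunctions.ExpDeriv
import Mathlib.Analysis.Complex.RealDeriv

/-!
# Differentiable vectors along scalar one-parameter groups; the Heisenberg models

File #4 (`WeilThetaModelDeriv`) reduced the analytic input `hF` of the PerL end-state records to the
model-level predicate `M.HasSKDerivAt γ γ' s₀` — differentiability of a curve in `𝒮^κ` for WEIL's topology —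
and left the verification of that predicate on constructed models as the residual.  This file discharges it in
the one situation the constructed archimedean models of the package actually present.

## 1. Abstract (any linear Weil theta model)

* `hasSKDerivAt_smul_const`: if `c : ℝ → ℂ` has derivative `c'` at `s₀` and `z ↦ z • Φ : ℂ → 𝒮^κ` is
  continuous (automatic on every model whose `S(X)` is a topological vector space, but NOT part of the abstract
  `LinearStr` interface, hence a hypothesis here), then `s ↦ c(s) • Φ` has `SK`-derivative `c' • Φ` at `s₀`;
* `hasSKDerivAt_orbit_of_omg_eq_smul`: consequently, along any curve `e : ℝ → G` through elements acting on
  `Φ` by scalars, `ω(e(s))Φ = c(s) • Φ`, the orbit map has `SK`-derivative `c' • Φ`;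
* `continuous_smul_SK_iff`: the continuity hypothesis is checked in `S(X)` (the topology of `𝒮^κ` is induced).

## 2. The Schrödinger–Heisenberg models

In every model of the Heisenberg family (`heisenbergModel`, `…OverLattice`, `…Std`, §2; the adjoin family
`heisenbergAdjoinModel` on `Heis V ⋊ D` — parabolic `P_S`, … — whose adjoined group `D` is discrete, §3; the
Weyl-element model `heisenbergWeylModel` on `Heis V ⋊ ⟨σ⟩`, §4) the group `G` whose action `ω` is differentiated is the CENTRE `Z(Heis V) ≅ U(1)` OF THE
HEISENBERG GROUP (not a unitary group `U(W_b)` of the dual pair), acting through the central character `z ↦ z^m` (`heisenbergModel_omg`, `heisenbergAdjoinModel_omg : ω(z)Φ = z^m • Φ`, from the tree's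
`repCLM_center` / `repSD_inl_apply`).  Hence

* `hasSKDerivAt_heisenbergModel_center`: along any curve `c : ℝ → U(1)` with `s ↦ (c s)^m` differentiable,
  every `Φ ∈ 𝒮^κ` is a differentiable vector IN THE SCHWARTZ TOPOLOGY, derivative `c' • Φ`;
* `hasSKDerivAt_heisenbergModel_fourierChar`: along `s ↦ 𝐞(s) = e^{2πis}` the derivative is `(2πi m) • Φ`
  (`hasDerivAt_coe_fourierChar_zpow_zero`), and `tendsto_heisenbergModel_fourierChar_sub_smul` is the same
  fact in the `s⁻¹ • (ω(𝐞 s)Φ - Φ) → (2πi m) • Φ` shape of the end-state `smooth` fields;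
* `hasSKDerivAt_heisenbergModelStd_fourierChar`: the hypothesis-free instance `V = ℝⁿ`, `L = ℤⁿ`;
* `hasSKDerivAt_heisenbergAdjoinModel_center` / `_fourierChar`, `hasSKDerivAt_heisenbergWeylModel_center` /
  `_fourierChar`: the same for the adjoin family (§3) and the Weyl-element model (§4).

What this shows and what it does not: the residual input of file #4 is satisfiable — non-vacuously, with the
expected generator — on these models; but in THIS family the `ω`-group `G` is the Heisenberg centre and the
adjoined symplectic part is discrete, so the only `ω`-directions are central.  The kernel model
`HeisenbergKernel.centerModel` (pv15-g5, RUN 29) swaps the two slots — there `G = Heis V` acts through `ω` by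
`ρ_m` — so every one-parameter subgroup of the Heisenberg group is an `ω`-direction of a constructed model; its
`HasSKDerivAt` is the `𝓢`-level infinitesimal Schrödinger representation (pv14-g6 `SchrodingerInfinitesimal`,
RUN 30) transported by `hasSKDerivAt_iff_val` of file #4 (not done in this file).  The directions PerL
differentiates along — ladder elements of `𝔲(W_b)_ℂ`, `U(W_b) ↪ Mp` acting by the Weil representation; for
definite `W_b` these are `𝔨`-directions (Hermite operator / `e^{t𝒥}` on the Schrödinger side, rotations on the
Fock side, cf. pv05-g7 `FockOneParameter` at the `L²` level) — are exercised by no constructed `WeilThetaModel`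
of the package so far.
-/

noncomputable section

open Filter Topology
open scoped Real FourierTransform SchwartzMap

namespace HodgeCM

/-! ## 0. A scalar derivative: `d/ds (𝐞 s)^m = 2πi m (𝐞 s)^m` at `s = 0` -/

/-- `s ↦ (e^{2πis})^m` has derivative `2πi m` at `0` (`m : ℤ`). -/
theorem hasDerivAt_coe_fourierChar_zpow_zero (m : ℤ) :
    HasDerivAt (fun s : ℝ => ((𝐞 s : Circle) : ℂ) ^ m) (2 * π * Complex.I * m) 0 := by
  have h1 : HasDerivAt (fun s : ℝ => 2 * π * s) (2 * π * 1) 0 :=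
    (hasDerivAt_id' (0 : ℝ)).const_mul (2 * π)
  have h5 := ((h1.ofReal_comp.mul_const Complex.I).const_mul (m : ℂ)).cexp
  have hf : (fun s : ℝ => ((𝐞 s : Circle) : ℂ) ^ m) =
      fun s : ℝ => Complex.exp ((m : ℂ) * (((2 * π * s : ℝ) : ℂ) * Complex.I)) := by
    funext s
    rw [Real.fourierChar_apply, ← Complex.exp_int_mul]
  rw [hf]
  refine h5.congr_deriv ?_
  simp only [mul_zero, Complex.ofReal_zero, zero_mul, Complex.exp_zero, one_mul, mul_one]
  push_cast
  ring

namespace WeilThetaModel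

variable {GU : Type} [Group GU] [TopologicalSpace GU] {ΓU : Subgroup GU}
variable {G : Type} [Group G] [TopologicalSpace G] {Γ : Subgroup G}
variable {M : WeilThetaModel GU ΓU G Γ} [M.LinearStr]

/-! ## 1. Scalar curves in `𝒮^κ` -/

/-- Continuity of `z ↦ z • Φ : ℂ → 𝒮^κ` is continuity of `z ↦ z • Φ : ℂ → S(X)` (induced topology). -/
theorem continuous_smul_SK_iff (Φ : M.SK) :
    (Continuous fun z : ℂ => z • Φ) ↔ Continuous fun z : ℂ => z • (Φ : M.W.SX) :=
  Topology.IsInducing.subtypeVal.continuous_iff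

/-- **Scalar curves are `SK`-differentiable**: if `c` has derivative `c'` at `s₀` and `z ↦ z • Φ` is continuous,
then `s ↦ c(s) • Φ` has `SK`-derivative `c' • Φ` at `s₀` (Weil's topology). -/
theorem hasSKDerivAt_smul_const {c : ℝ → ℂ} {c' : ℂ} {s₀ : ℝ} (hc : HasDerivAt c c' s₀) (Φ : M.SK)
    (hΦ : Continuous fun z : ℂ => z • Φ) : M.HasSKDerivAt (fun s => c s • Φ) (c' • Φ) s₀ := by
  rw [hasSKDerivAt_iff_tendsto_coe_smul]
  have h2 : Tendsto (fun s => slope c s₀ s • Φ) (𝓝[≠] s₀) (𝓝 (c' • Φ)) :=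
    (hΦ.tendsto c').comp (hasDerivAt_iff_tendsto_slope.mp hc)
  refine h2.congr fun s => ?_
  simp only [slope_def_module, Complex.real_smul, Complex.ofReal_inv, ← sub_smul, smul_smul]

/-- **Orbit maps along scalar-acting curves**: if `ω(e(s))Φ = c(s) • Φ` for all `s`, `c` has derivative `c'`
at `s₀` and `z ↦ z • Φ` is continuous, then `s ↦ ω(e(s))Φ` has `SK`-derivative `c' • Φ` at `s₀`. -/
theorem hasSKDerivAt_orbit_of_omg_eq_smul (e : ℝ → G) (c : ℝ → ℂ) {c' : ℂ} {s₀ : ℝ} (Φ : M.SK)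
    (hω : ∀ s, M.omg (e s) Φ = c s • Φ) (hc : HasDerivAt c c' s₀) (hΦ : Continuous fun z : ℂ => z • Φ) :
    M.HasSKDerivAt (fun s => M.omg (e s) Φ) (c' • Φ) s₀ := by
  have h : (fun s => M.omg (e s) Φ) = fun s => c s • Φ := funext hω
  rw [h]
  exact hasSKDerivAt_smul_const hc Φ hΦ

end WeilThetaModel

/-! ## 2. The Schrödinger–Heisenberg models: the centre acts by `z ↦ z^m` -/

namespace SchwartzWeil

open WeilThetaModel

section Heisenberg

variable (V : Type) [NormedAddCommGroup V] [InnerProductSpace ℝ V] [FiniteDimensional ℝ V] [MeasurableSpace V]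
  [BorelSpace V] (L : Submodule ℤ V) (m : ℤ) [DiscreteTopology L] (Γ : Subgroup Circle)
  (hΓ : ∀ u ∈ Γ, u ^ m = 1)

/-- In `heisenbergModel`, `ω(z)Φ = ρ_m(c(z)) Φ` on representatives. -/
theorem heisenbergModel_coe_omg (z : Circle) (Φ : (heisenbergModel V L m Γ hΓ).SK) :
    ((heisenbergModel V L m Γ hΓ).omg z Φ).1 = repCLM V m (1 * Heis.center z) Φ.1 := rfl

/-- **The centre acts by the character `z ↦ z^m` on `𝒮^κ`**: `ω(z)Φ = z^m • Φ`. -/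
theorem heisenbergModel_omg (z : Circle) (Φ : (heisenbergModel V L m Γ hΓ).SK) :
    (heisenbergModel V L m Γ hΓ).omg z Φ = ((z : ℂ) ^ m) • Φ := by
  apply Subtype.ext
  rw [heisenbergModel_coe_omg, one_mul, repCLM_center, Circle.coe_zpow]
  rfl

/-- `z ↦ z • Φ : ℂ → 𝒮^κ` is continuous in the Heisenberg model (Schwartz topology). -/
theorem continuous_smul_SK_heisenbergModel (Φ : (heisenbergModel V L m Γ hΓ).SK) :
    Continuous fun z : ℂ => z • Φ := by
  rw [continuous_smul_SK_iff]
  exact (continuous_id.smul continuous_const : Continuous fun z : ℂ => z • (show 𝓢(V, ℂ) from Φ.1))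

/-- **Every `Φ ∈ 𝒮^κ` is a differentiable vector of `ω` along every differentiable central curve, in Weil's
topology**: if `s ↦ (c s)^m ∈ ℂ` has derivative `c'` at `s₀`, then `s ↦ ω(c(s))Φ` has `SK`-derivative `c' • Φ`. -/
theorem hasSKDerivAt_heisenbergModel_center {c : ℝ → Circle} {c' : ℂ} {s₀ : ℝ}
    (hc : HasDerivAt (fun s => ((c s : Circle) : ℂ) ^ m) c' s₀) (Φ : (heisenbergModel V L m Γ hΓ).SK) :
    (heisenbergModel V L m Γ hΓ).HasSKDerivAt (fun s => (heisenbergModel V L m Γ hΓ).omg (c s) Φ)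
      (c' • Φ) s₀ :=
  hasSKDerivAt_orbit_of_omg_eq_smul c (fun s => ((c s : Circle) : ℂ) ^ m) Φ
    (fun s => heisenbergModel_omg V L m Γ hΓ (c s) Φ) hc (continuous_smul_SK_heisenbergModel V L m Γ hΓ Φ)

/-- Along `s ↦ 𝐞(s) = e^{2πis}`: `SK`-derivative `(2πi m) • Φ` at `s = 0`. -/
theorem hasSKDerivAt_heisenbergModel_fourierChar (Φ : (heisenbergModel V L m Γ hΓ).SK) :
    (heisenbergModel V L m Γ hΓ).HasSKDerivAt (fun s => (heisenbergModel V L m Γ hΓ).omg (𝐞 s) Φ)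
      ((2 * π * Complex.I * m : ℂ) • Φ) 0 :=
  hasSKDerivAt_heisenbergModel_center V L m Γ hΓ (hasDerivAt_coe_fourierChar_zpow_zero m) Φ

/-- The same fact in the shape of the end-state `smooth` fields: `s⁻¹ • (ω(𝐞 s)Φ - Φ) → (2πi m) • Φ` in `𝒮^κ`
as `s → 0`, `s ≠ 0`. -/
theorem tendsto_heisenbergModel_fourierChar_sub_smul (Φ : (heisenbergModel V L m Γ hΓ).SK) :
    Tendsto (fun s : ℝ => ((s : ℝ) : ℂ)⁻¹ • ((heisenbergModel V L m Γ hΓ).omg (𝐞 s) Φ - Φ)) (𝓝[≠] 0)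
      (𝓝 ((2 * π * Complex.I * m : ℂ) • Φ)) := by
  have h := hasSKDerivAt_zero_iff_tendsto_coe_smul.mp (hasSKDerivAt_heisenbergModel_fourierChar V L m Γ hΓ Φ)
  simpa only [AddChar.map_zero_eq_one, WeilThetaModel.omg_one] using h

/-- Operator-norm form (file #4's `hF` shape) for the compact-quotient variant `heisenbergModelOverLattice`:
`d/ds|₀ L ∘ T^c_{ω(𝐞 s)Φ} = L ∘ T^c_{(2πi m)Φ}`. -/
theorem hasSKDerivAt_heisenbergModelOverLattice_fourierChar [IsZLattice ℝ L] [NeZero m] [Finite Γ]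
    (Φ : (heisenbergModelOverLattice V L m Γ hΓ).SK) :
    (heisenbergModelOverLattice V L m Γ hΓ).HasSKDerivAt
      (fun s => (heisenbergModelOverLattice V L m Γ hΓ).omg (𝐞 s) Φ) ((2 * π * Complex.I * m : ℂ) • Φ) 0 :=
  hasSKDerivAt_heisenbergModel_fourierChar V L m Γ hΓ Φ

end Heisenberg

/-! ## 3. The adjoin family `Heis V ⋊ D` (parabolic `P_S`, …): `D` discrete, `G` the centre again -/

section Adjoin

-- (`π` is taken by `Real.pi` here, so the adjoined representation is called `ρ`.)
variable (V : Type) [NormedAddCommGroup V] [InnerProductSpace ℝ V] [FiniteDimensional ℝ V] [MeasurableSpace V]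
  [BorelSpace V] (L : Submodule ℤ V) (m : ℤ) {D : Type} [Group D] [TopologicalSpace D] [DiscreteTopology D]
  {φ : D →* MulAut (Heis V)} {ρ : D →* (𝓢(V, ℂ) →L[ℂ] 𝓢(V, ℂ))ˣ} [DiscreteTopology L]
  [IsTopologicalGroup (Heis V ⋊[φ] D)]
  (hφc : ∀ (d : D) (z : Circle), φ d (Heis.center z) = Heis.center z) (hc : Intertwines V m φ ρ)
  (hθ : FixesTheta V L m ρ) (Γ : Subgroup Circle) (hΓ : ∀ u ∈ Γ, u ^ m = 1)

/-- In `heisenbergAdjoinModel`, `ω(z)Φ = ρ(c(z)) Φ` on representatives. -/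
theorem heisenbergAdjoinModel_coe_omg (z : Circle) (Φ : (heisenbergAdjoinModel V L m hφc hc hθ Γ hΓ).SK) :
    ((heisenbergAdjoinModel V L m hφc hc hθ Γ hΓ).omg z Φ).1 =
      (repSD V m hc (1 * HeisSD.center z) : 𝓢(V, ℂ) →L[ℂ] 𝓢(V, ℂ)) Φ.1 := rfl

/-- **The centre acts by `z ↦ z^m` in every adjoin model** (`heisenbergPsModel` and its lattice / `Std`
variants are instances of `heisenbergAdjoinModel` by definition; the Weyl-element model has its own §4). -/
theorem heisenbergAdjoinModel_omg (z : Circle) (Φ : (heisenbergAdjoinModel V L m hφc hc hθ Γ hΓ).SK) :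
    (heisenbergAdjoinModel V L m hφc hc hθ Γ hΓ).omg z Φ = ((z : ℂ) ^ m) • Φ := by
  apply Subtype.ext
  rw [heisenbergAdjoinModel_coe_omg, one_mul, HeisSD.center_apply, repSD_inl_apply, repCLM_center, Circle.coe_zpow]
  rfl

/-- `z ↦ z • Φ : ℂ → 𝒮^κ` is continuous in the adjoin model (Schwartz topology). -/
theorem continuous_smul_SK_heisenbergAdjoinModel (Φ : (heisenbergAdjoinModel V L m hφc hc hθ Γ hΓ).SK) :
    Continuous fun z : ℂ => z • Φ := by
  rw [continuous_smul_SK_iff]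
  exact (continuous_id.smul continuous_const : Continuous fun z : ℂ => z • (show 𝓢(V, ℂ) from Φ.1))

/-- **Differentiable vectors along central curves, adjoin family** (Schwartz topology). -/
theorem hasSKDerivAt_heisenbergAdjoinModel_center {c : ℝ → Circle} {c' : ℂ} {s₀ : ℝ}
    (hd : HasDerivAt (fun s => ((c s : Circle) : ℂ) ^ m) c' s₀)
    (Φ : (heisenbergAdjoinModel V L m hφc hc hθ Γ hΓ).SK) :
    (heisenbergAdjoinModel V L m hφc hc hθ Γ hΓ).HasSKDerivAt
      (fun s => (heisenbergAdjoinModel V L m hφc hc hθ Γ hΓ).omg (c s) Φ) (c' • Φ) s₀ :=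
  hasSKDerivAt_orbit_of_omg_eq_smul c (fun s => ((c s : Circle) : ℂ) ^ m) Φ
    (fun s => heisenbergAdjoinModel_omg V L m hφc hc hθ Γ hΓ (c s) Φ) hd
    (continuous_smul_SK_heisenbergAdjoinModel V L m hφc hc hθ Γ hΓ Φ)

/-- Along `s ↦ 𝐞(s)`: `SK`-derivative `(2πi m) • Φ` at `0`, adjoin family. -/
theorem hasSKDerivAt_heisenbergAdjoinModel_fourierChar (Φ : (heisenbergAdjoinModel V L m hφc hc hθ Γ hΓ).SK) :
    (heisenbergAdjoinModel V L m hφc hc hθ Γ hΓ).HasSKDerivAt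
      (fun s => (heisenbergAdjoinModel V L m hφc hc hθ Γ hΓ).omg (𝐞 s) Φ) ((2 * π * Complex.I * m : ℂ) • Φ) 0 :=
  hasSKDerivAt_heisenbergAdjoinModel_center V L m hφc hc hθ Γ hΓ (hasDerivAt_coe_fourierChar_zpow_zero m) Φ

end Adjoin

/-! ## 4. The Weyl-element model `Heis V ⋊ ⟨σ⟩` (`σ` acting by `𝓕`, self-dual lattice): `G` the centre again -/

section Weyl

variable (V : Type) [NormedAddCommGroup V] [InnerProductSpace ℝ V] [FiniteDimensional ℝ V] [MeasurableSpace V]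
  [BorelSpace V] (L : Submodule ℤ V) (m : ℤ) (hm : m ≠ 0) [DiscreteTopology L] [IsZLattice ℝ L]
  (hL : PoissonSummation.dualLattice L = L) (Γ : Subgroup Circle) (hΓ : ∀ u ∈ Γ, u ^ m = 1)

/-- In `heisenbergWeylModel`, `ω(z)Φ = ρ(c(z)) Φ` on representatives. -/
theorem heisenbergWeylModel_coe_omg (z : Circle) (Φ : (heisenbergWeylModel V L m hm hL Γ hΓ).SK) :
    ((heisenbergWeylModel V L m hm hL Γ hΓ).omg z Φ).1 =
      (repW V m hm (1 * HeisW.center z) : 𝓢(V, ℂ) →L[ℂ] 𝓢(V, ℂ)) Φ.1 := rfl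

/-- **The centre acts by `z ↦ z^m` in the Weyl-element model.** -/
theorem heisenbergWeylModel_omg (z : Circle) (Φ : (heisenbergWeylModel V L m hm hL Γ hΓ).SK) :
    (heisenbergWeylModel V L m hm hL Γ hΓ).omg z Φ = ((z : ℂ) ^ m) • Φ := by
  apply Subtype.ext
  rw [heisenbergWeylModel_coe_omg, one_mul, HeisW.center_apply, repW_inl_apply, repCLM_center, Circle.coe_zpow]
  rfl

/-- `z ↦ z • Φ : ℂ → 𝒮^κ` is continuous in the Weyl-element model (Schwartz topology). -/
theorem continuous_smul_SK_heisenbergWeylModel (Φ : (heisenbergWeylModel V L m hm hL Γ hΓ).SK) :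
    Continuous fun z : ℂ => z • Φ := by
  rw [continuous_smul_SK_iff]
  exact (continuous_id.smul continuous_const : Continuous fun z : ℂ => z • (show 𝓢(V, ℂ) from Φ.1))

/-- **Differentiable vectors along central curves, Weyl-element model** (Schwartz topology). -/
theorem hasSKDerivAt_heisenbergWeylModel_center {c : ℝ → Circle} {c' : ℂ} {s₀ : ℝ}
    (hd : HasDerivAt (fun s => ((c s : Circle) : ℂ) ^ m) c' s₀)
    (Φ : (heisenbergWeylModel V L m hm hL Γ hΓ).SK) :
    (heisenbergWeylModel V L m hm hL Γ hΓ).HasSKDerivAt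
      (fun s => (heisenbergWeylModel V L m hm hL Γ hΓ).omg (c s) Φ) (c' • Φ) s₀ :=
  hasSKDerivAt_orbit_of_omg_eq_smul c (fun s => ((c s : Circle) : ℂ) ^ m) Φ
    (fun s => heisenbergWeylModel_omg V L m hm hL Γ hΓ (c s) Φ) hd
    (continuous_smul_SK_heisenbergWeylModel V L m hm hL Γ hΓ Φ)

/-- Along `s ↦ 𝐞(s)`: `SK`-derivative `(2πi m) • Φ` at `0`, Weyl-element model. -/
theorem hasSKDerivAt_heisenbergWeylModel_fourierChar (Φ : (heisenbergWeylModel V L m hm hL Γ hΓ).SK) :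
    (heisenbergWeylModel V L m hm hL Γ hΓ).HasSKDerivAt
      (fun s => (heisenbergWeylModel V L m hm hL Γ hΓ).omg (𝐞 s) Φ) ((2 * π * Complex.I * m : ℂ) • Φ) 0 :=
  hasSKDerivAt_heisenbergWeylModel_center V L m hm hL Γ hΓ (hasDerivAt_coe_fourierChar_zpow_zero m) Φ

end Weyl

/-- **Hypothesis-free instance** (`V = ℝⁿ`, `L = ℤⁿ`, `Γ = 1`): in `heisenbergModelStd n m` every `Φ ∈ 𝒮^κ` is a
differentiable vector of `ω` along `s ↦ e^{2πis}`, in the Schwartz topology, with derivative `(2πi m) • Φ`. -/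
theorem hasSKDerivAt_heisenbergModelStd_fourierChar (n : ℕ) (m : ℤ) [NeZero m] (Φ : (heisenbergModelStd n m).SK) :
    (heisenbergModelStd n m).HasSKDerivAt (fun s => (heisenbergModelStd n m).omg (𝐞 s) Φ)
      ((2 * π * Complex.I * m : ℂ) • Φ) 0 :=
  hasSKDerivAt_heisenbergModel_fourierChar (EuclideanSpace ℝ (Fin n))
    (Submodule.span ℤ (Set.range (PiLp.basisFun 2 ℝ (Fin n)))) m ⊥
    (fun u hu => by rw [Subgroup.mem_bot.mp hu, one_zpow]) Φ

end SchwartzWeil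

end HodgeCM
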